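import Summits.BirchSwinnertonDyer.BirchSwinnertonDyer.Theorems.ManinLocalTwoThreeStevensNaturalTes75
import Summits.BirchSwinnertonDyer.BirchSwinnertonDyer.Theorems.ManinLocalTwoThreeStevensCuspRationalHolds
import Summits.BirchSwinnertonDyer.BirchSwinnertonDyer.Theorems.ManinLocalTwoThreeStevensShimuraKernelRational
import Summits.BirchSwinnertonDyer.BirchSwinnertonDyer.Theorems.ManinLocalTwoThreeShimuraKernelCyclicLattice
import Summits.BirchSwinnertonDyer.BirchSwinnertonDyer.Theorems.ManinLocalTwoThreeShimuraKernelOddPart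
import HarnessLib

/-!
# The Shimura-kernel rows with their printed inputs discharged: desc row 1 and E-an-152b ⟸ modularity alone; E-es-189 ⟸ Mazur alone, for EVERY datum
(route `ManinLocalTwoThree`, crux C2 `ManinOddAtFour` stmt-BirchSwinnertonDyer-22967; cell bsd-f2-manin, prover seat p3 gen 21;
`--supports stmt-BirchSwinnertonDyer-22967`)

One-line consequences of the cell's discharges (T-es-75 `StevensGalois.optimalGamma1Parametrization_cuspInv_galoisAction_holds`, F★
`CuspValues.optimalGamma1Parametrization_cusp_rational_holds`, the lattice-clause-free Stevens twin `CuspValues.exists_optimal_gamma1ParametrizationData_flat_of_datum`)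
applied to rows whose tree proofs still carry those inputs as binders:

* §1 ⟸ modularity ALONE (through LEAD's `StevensGalois.shimuraKernelCyclic_of_modularity` and desc's proved glue; desc g26 row 1 is p2's
  `NaturalTes75.gamma1PeriodsNotInsideTwice_of_modularity_naturalTes75` already): E-an-152b `ShimuraKernel.ShimuraIndexNeFourAtFour`
  (`shimuraIndexNeFourAtFour_of_modularity`), and «no prime inclusion `Λ₁(f) ⊆ ℓΛ₀(f)`» for EVERY `X₀(N)`-datum and every prime `ℓ`
  (`not_periodLatticeGamma1_le_prime_mul_of_modularity`; no lattice clause).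
* §2 ⟸ MAZUR ALONE (no modularity): E-es-189 — «`Λ₁(f) ⊄ ℓΛ₀(f)` for every ODD prime `ℓ`» for EVERY `X₀(N)`-datum
  (`not_periodLatticeGamma1_le_oddPrime_mul_of_mazur`; p2's `ShimuraKernelOddPart.not_prime_le_of_isOptimal` on the Stevens twin with F★ discharged),
  i.e. the odd part of `Λ₀(f)/Λ₁(f)` is cyclic granted Mazur's theorem only.

HONEST FRAMING: §1 is CONDITIONAL on `exists_isNewformOf` (modularity), §2 on the statement-only printed fact `mazur_torsion`; nothing about C2/C3,
Manin's conjecture or BSD is proved.  No definitions, no sorry.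
[cite: Stevens1989, §2] [cite: Vatsal2005, Rem. 1.8, Conj. 1.9] [cite: Mazur1977, Thm. (8)] [cite: LingOesterle1991, Thm. 2]
-/

set_option autoImplicit false
-- lint-debt: the directory name repeats the summit name (sibling precedent `ManinLocalTwoThreeStevensCurveConsumers.lean`)
set_option linter.dupNamespace false

noncomputable section

open CongruenceSubgroup WeierstrassCurve
open Literature.NumberTheory.EllipticCurves Literature.NumberTheory.EllipticCurves.ModularForms
open Summit.BirchSwinnertonDyer.Rank1Residual.ManinAdditive

namespace Summit.BirchSwinnertonDyer.BirchSwinnertonDyer.Theorems.ManinLocalTwoThree.StevensCurve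

/-! ## §1 ⟸ modularity alone -/

-- desc g26 row 1 `Gamma1PeriodsNotInsideTwiceGamma0Periods` ⟸ modularity alone is ALREADY in the tree:
-- `NaturalTes75.gamma1PeriodsNotInsideTwice_of_modularity_naturalTes75` (p2 g23, `…NaturalTes75Consumers.lean`) — not restated here.

/-- **E-an-152b `ShimuraIndexNeFourAtFour` ⟸ modularity alone** (via cyclicity; T-es-75 discharged).  CONDITIONAL on `exists_isNewformOf`.
[cite: Stevens1989, §2] -/
theorem shimuraIndexNeFourAtFour_of_modularity (hnf : exists_isNewformOf) : ShimuraKernel.ShimuraIndexNeFourAtFour :=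
  ShimuraCyclic.shimuraIndexNeFourAtFour_of_shimuraKernelCyclic (StevensGalois.shimuraKernelCyclic_of_modularity hnf)

/-- **No prime inclusion `Λ₁(f) ⊆ ℓΛ₀(f)`, for EVERY `X₀(N)`-datum and EVERY prime `ℓ`, ⟸ modularity alone** (cyclicity + the datum parity
lemma `ShimuraKernelLattice.not_prime_le_of_cyclic_datum`; no lattice clause).  CONDITIONAL on `exists_isNewformOf`. [cite: Vatsal2005, Rem. 1.8] -/
theorem not_periodLatticeGamma1_le_prime_mul_of_modularity (hnf : exists_isNewformOf)
    (W₀ : WeierstrassCurve ℚ) [W₀.IsElliptic] {N : ℕ} [NeZero N] (D₀ : ModularParametrizationData W₀ N) {ℓ : ℕ} (hℓ : ℓ.Prime) :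
    ¬ (∀ z ∈ periodLatticeGamma1 D₀.f, ∃ w ∈ periodLattice D₀.f, z = (ℓ : ℂ) * w) := by
  obtain ⟨z₀, hz₀, hcyc⟩ := StevensGalois.shimuraKernelCyclic_of_modularity hnf W₀ D₀
  exact ShimuraKernelLattice.not_prime_le_of_cyclic_datum D₀ hz₀ hcyc hℓ

/-- In particular `Λ₁(f) ⊄ 2Λ₀(f)` for every datum ⟸ modularity alone (the `2`-part, E-es-188, lattice-clause-free). [cite: Stevens1989, §2] -/
theorem not_halfIndex_of_modularity (hnf : exists_isNewformOf)
    (W₀ : WeierstrassCurve ℚ) [W₀.IsElliptic] {N : ℕ} [NeZero N] (D₀ : ModularParametrizationData W₀ N) :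
    ¬ (∀ z ∈ periodLatticeGamma1 D₀.f, ∃ w ∈ periodLattice D₀.f, z = 2 * w) := by
  exact_mod_cast not_periodLatticeGamma1_le_prime_mul_of_modularity hnf W₀ D₀ Nat.prime_two

/-! ## §2 ⟸ Mazur alone: the odd part -/

/-- **E-es-189 for EVERY `X₀(N)`-datum ⟸ Mazur's torsion theorem ALONE**: `Λ₁(f) ⊄ ℓΛ₀(f)` for every odd prime `ℓ` (p2's
`ShimuraKernelOddPart.not_prime_le_of_isOptimal` on the lattice-clause-free Stevens twin, F★ discharged by its tree theorem).
CONDITIONAL on `mazur_torsion`. [cite: Mazur1977, Thm. (8)] [cite: Vatsal2005, Rem. 1.8] -/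
theorem not_periodLatticeGamma1_le_oddPrime_mul_of_mazur (hMT : ∀ V : WeierstrassCurve ℚ, mazur_torsion V)
    (W₀ : WeierstrassCurve ℚ) [W₀.IsElliptic] {N : ℕ} [NeZero N] (D₀ : ModularParametrizationData W₀ N)
    {ℓ : ℕ} (hℓ : ℓ.Prime) (hℓ2 : ℓ ≠ 2) :
    ¬ (∀ z ∈ periodLatticeGamma1 D₀.f, ∃ w ∈ periodLattice D₀.f, z = (ℓ : ℂ) * w) := by
  obtain ⟨W₁, hW₁, D₁, hf, -, hD₁, -, -⟩ := CuspValues.exists_optimal_gamma1ParametrizationData_flat_of_datum D₀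
  rw [← hf]
  exact ShimuraKernelOddPart.not_prime_le_of_isOptimal CuspValues.optimalGamma1Parametrization_cusp_rational_holds hMT D₁ hD₁ hℓ hℓ2

end Summit.BirchSwinnertonDyer.BirchSwinnertonDyer.Theorems.ManinLocalTwoThree.StevensCurve

end
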